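import Summits.CriticalPhenomena.CardyFormulaZ2.Theorems.CardyMagicRigidityNestingRigidityNeckZ2ErrorCoverChain
import HarnessLib

/-!
# Crux `NestingRigidity`, line `pinch-resampling` (v4), stub S12: the necklace in normal form (rank-indexed sequences)

Crux `Summit.CriticalPhenomena.CardyFormulaZ2.Theses.CardyMagicRigidity.NestingRigidity`
(stmt-CriticalPhenomena-4835), line `pinch-resampling` v4, stub S12 `stub_neckHookupCoarseZ2 : NeckHookupCoarseZ2`.
Interface brick of the summation of the necklace bound `ZNodeAbsBoundChainA` (`…NeckZ2ErrorCoverChain`; amended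
plan in the module docstring of `…NestingRigidityGapEntropy`, worker W6a): the necklace node event
`ZNodeEventChainA ℓ lam s x o` quantifies over a finite family `F` of virtual edges with an injective rank and
inner/outer endpoints; every downstream argument (hierarchy, node certificates, arms) only needs the data SORTED BY
RANK.  This file performs the sorting once and for all:

* `Necklace ω ℓ lam s x` — the normal form: a number of hops `k ≥ 1`, locales `p 0, …, p (k-1)` on the inner layer,
  inner and outer endpoints `inn i, out i` within sup distance `< ℓ` of `p i` (one of them IS `p i`), and two collar
  crossings `b, b'`, such that inside the big ball `Λ_{2s}(x)`: `b ⟶ inn 0`, `out i ⟶ inn (i+1)`,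
  `out (k-1) ⟶ b'` by open paths, `b ≁ out i`, `out i ≁ out j` (`i < j`), `b` and `b'` are joined to sup distance
  `2s` from `x`, and every locale `p i` is joined to two points at mutual sup distance `≥ lam` (its blob is big).
* `Necklace.u` — the cluster representatives `u 0 = b`, `u (i+1) = out i`, with the necklace API: `path_u_inn`
  (`u i ⟶ inn i`), `not_path_u_u` (pairwise distinct clusters inside `Λ_{2s}(x)`), `u_zero_far`, `u_last_far`.
* `exists_necklace` (registered anchor `necklace_of_chainA`): every `ω ∈ ZNodeEventChainA ℓ lam s x o` (`1 ≤ ℓ`)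
  carries a `Necklace ω ℓ lam s x` (sort `F` by rank with `Finset.orderEmbOfFin`).
-/

noncomputable section

namespace Summit.CriticalPhenomena.CardyFormulaZ2.Cruxes.NestingRigidity.PinchResampling

open MeasureTheory Set Literature.Probability.Percolation Literature.Probability.LatticeModels
open ZPinchLocality
open NeckCoarseZ2

/-! ## §1 The normal form -/

/-- **A necklace in normal form** on the configuration `ω` (collar `Λ_{2s}(x) ∖ Λ_s(x)`, resolution `ℓ`, bigness
scale `lam`): `k ≥ 1` hops at the locales `p i` (inner-layer vertices), inner/outer endpoints `inn i, out i` within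
sup distance `< ℓ` of `p i`, collar crossings `b, b'`; the open clusters of `b = u 0, out 0 = u 1, …, out (k-1) = u k`
inside `Λ_{2s}(x)` are pairwise distinct, consecutive ones meet near consecutive locales, the end ones reach sup
distance `2s` from `x`, and every locale has a big cluster through it. -/
structure Necklace (ω : BondConfig (Site 2)) (ℓ lam s : ℕ) (x : Site 2) where
  /-- The number of hops (virtual edges). -/
  k : ℕ
  /-- There is at least one hop. -/
  one_le : 1 ≤ k
  /-- The locales (second components of the virtual edges), by increasing rank. -/
  p : ℕ → Site 2
  /-- The inner endpoints. -/
  inn : ℕ → Site 2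
  /-- The outer endpoints. -/
  out : ℕ → Site 2
  /-- The first collar crossing. -/
  b : Site 2
  /-- The last collar crossing. -/
  b' : Site 2
  /-- Locales lie on the inner layer. -/
  p_mem : ∀ i < k, p i ∈ innerLayer (zdGraph 2) (zBall x s) (zBall x (2 * s))
  /-- The locale is one of the two endpoints. -/
  p_eq : ∀ i < k, p i = inn i ∨ p i = out i
  /-- The inner endpoint is `ℓ`-close to the locale. -/
  inn_near : ∀ i < k, zNorm (inn i - p i) < ℓ
  /-- The outer endpoint is `ℓ`-close to the locale. -/
  out_near : ∀ i < k, zNorm (out i - p i) < ℓ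
  /-- `b` is joined to the first inner endpoint. -/
  path_b_inn : PathIn (openGraph ω) (zBall x (2 * s)) b (inn 0)
  /-- Consecutive clusters: `out i ⟶ inn (i + 1)`. -/
  path_out_inn : ∀ i, i + 1 < k → PathIn (openGraph ω) (zBall x (2 * s)) (out i) (inn (i + 1))
  /-- The last outer endpoint is joined to `b'`. -/
  path_out_b' : PathIn (openGraph ω) (zBall x (2 * s)) (out (k - 1)) b'
  /-- `b` is joined to no outer endpoint. -/
  not_b_out : ∀ i < k, ¬ PathIn (openGraph ω) (zBall x (2 * s)) b (out i)
  /-- Distinct outer endpoints are not joined. -/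
  not_out_out : ∀ i j, i < j → j < k → ¬ PathIn (openGraph ω) (zBall x (2 * s)) (out i) (out j)
  /-- `b` reaches sup distance `2s` from the centre. -/
  b_far : ∃ w, zNorm (w - x) = 2 * s ∧ PathIn (openGraph ω) (zBall x (2 * s)) b w
  /-- `b'` reaches sup distance `2s` from the centre. -/
  b'_far : ∃ w, zNorm (w - x) = 2 * s ∧ PathIn (openGraph ω) (zBall x (2 * s)) b' w
  /-- Every locale lies in a big cluster: two points at sup distance `≥ lam` joined to it. -/
  big : ∀ i < k, ∃ w w', (lam : ℤ) ≤ zNorm (w - w') ∧ PathIn (openGraph ω) (zBall x (2 * s)) (p i) w ∧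
    PathIn (openGraph ω) (zBall x (2 * s)) (p i) w'

namespace Necklace

variable {ω : BondConfig (Site 2)} {ℓ lam s : ℕ} {x : Site 2} (N : Necklace ω ℓ lam s x)

/-- **Cluster representatives**: `u 0 = b`, `u (i + 1) = out i`. -/
def u (i : ℕ) : Site 2 := if i = 0 then N.b else N.out (i - 1)

/-- `u 0 = b`. -/
@[simp] theorem u_zero : N.u 0 = N.b := rfl

/-- `u (i + 1) = out i`. -/
@[simp] theorem u_succ (i : ℕ) : N.u (i + 1) = N.out i := by
  simp [u]

/-- **The cluster of `u i` meets the locale `p i`**: `u i ⟶ inn i` for `i < k`. -/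
theorem path_u_inn {i : ℕ} (hi : i < N.k) : PathIn (openGraph ω) (zBall x (2 * s)) (N.u i) (N.inn i) := by
  rcases i with _ | i
  · exact N.path_b_inn
  · rw [u_succ]
    exact N.path_out_inn i hi

/-- **The clusters of the `u i`, `i ≤ k`, are pairwise distinct inside `Λ_{2s}(x)`.** -/
theorem not_path_u_u {i j : ℕ} (hij : i < j) (hj : j ≤ N.k) :
    ¬ PathIn (openGraph ω) (zBall x (2 * s)) (N.u i) (N.u j) := by
  obtain ⟨j, rfl⟩ : ∃ j', j = j' + 1 := ⟨j - 1, by omega⟩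
  rw [u_succ]
  rcases i with _ | i
  · exact N.not_b_out j (by omega)
  · rw [u_succ]
    exact N.not_out_out i j (by omega) (by omega)

/-- The symmetric form of distinctness: for `i ≠ j`, `i, j ≤ k`. -/
theorem not_path_u_u' {i j : ℕ} (hij : i ≠ j) (hi : i ≤ N.k) (hj : j ≤ N.k) :
    ¬ PathIn (openGraph ω) (zBall x (2 * s)) (N.u i) (N.u j) := by
  rcases lt_or_gt_of_ne hij with h | h
  · exact N.not_path_u_u h hj
  · exact fun hp ↦ N.not_path_u_u h hi hp.symm

/-- **The first cluster reaches sup distance `2s` from the centre.** -/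
theorem u_zero_far : ∃ w, zNorm (w - x) = 2 * s ∧ PathIn (openGraph ω) (zBall x (2 * s)) (N.u 0) w := N.b_far

/-- **The last cluster reaches sup distance `2s` from the centre.** -/
theorem u_last_far : ∃ w, zNorm (w - x) = 2 * s ∧ PathIn (openGraph ω) (zBall x (2 * s)) (N.u N.k) w := by
  obtain ⟨w, hw, hp⟩ := N.b'_far
  obtain ⟨k', hk'⟩ : ∃ k', N.k = k' + 1 := ⟨N.k - 1, by have := N.one_le; omega⟩
  refine ⟨w, hw, ?_⟩
  rw [hk', u_succ]
  have h := N.path_out_b'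
  rw [hk', Nat.add_sub_cancel] at h
  exact h.trans hp

/-- **The cluster of `u (i + 1)` meets the locale `p i`** (through `out i = u (i + 1)` itself). -/
theorem zNorm_u_succ_sub_lt {i : ℕ} (hi : i < N.k) : zNorm (N.u (i + 1) - N.p i) < ℓ := by
  rw [u_succ]
  exact N.out_near i hi

/-- Locales are at sup distance `s + 1` from the centre. -/
theorem zNorm_p_sub {i : ℕ} (hi : i < N.k) : zNorm (N.p i - x) = s + 1 :=
  zNorm_eq_of_mem_innerLayer (N.p_mem i hi)

end Necklace

/-! ## §2 Sorting the necklace node event -/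

/-- **Every configuration of the necklace node event carries a necklace in normal form** (sort the family `F` of
`ZNodeEventChainA` by its injective rank). -/
theorem exists_necklace {ℓ lam s : ℕ} {x o : Site 2} {ω : BondConfig (Site 2)} (hℓ : 1 ≤ ℓ)
    (hω : ω ∈ ZNodeEventChainA ℓ lam s x o) : Nonempty (Necklace ω ℓ lam s x) := by
  classical
  obtain ⟨F, b, b', rk, inP, outP, hF, hne, hb, hb', -, hinj, hor, hmin, hmax, hcov, hb0, hlt⟩ := hω
  -- sort `F` by rank
  set k := F.card with hkdef
  have hk : 1 ≤ k := hne.card_pos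
  have hcard : (F.image rk).card = k := Finset.card_image_of_injOn hinj
  set r : Fin k ↪o ℕ := (F.image rk).orderEmbOfFin hcard with hrdef
  have hr_mem : ∀ i, ∃ e ∈ F, rk e = r i := fun i ↦ by
    simpa only [Finset.mem_image] using Finset.orderEmbOfFin_mem (F.image rk) hcard i
  choose edge hedgeF hedge using hr_mem
  -- every edge of `F` is enumerated
  have hsurj : ∀ e ∈ F, ∃ i, edge i = e := fun e he ↦ by
    have hmem : rk e ∈ Set.range r := by
      rw [hrdef, Finset.range_orderEmbOfFin, Finset.coe_image]
      exact mem_image_of_mem rk he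
    obtain ⟨i, hi⟩ := hmem
    exact ⟨i, hinj (hedgeF i) he (by rw [hedge i, hi])⟩
  -- `ℕ`-indexed enumeration
  set E : ℕ → Site 2 × Site 2 := fun i ↦ if h : i < k then edge ⟨i, h⟩ else edge ⟨0, hk⟩ with hEdef
  have hE : ∀ i (h : i < k), E i = edge ⟨i, h⟩ := fun i h ↦ dif_pos h
  have hEF : ∀ i < k, E i ∈ F := fun i h ↦ by rw [hE i h]; exact hedgeF _
  have hErk : ∀ i (h : i < k), rk (E i) = r ⟨i, h⟩ := fun i h ↦ by rw [hE i h, hedge]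
  have hlt_rk : ∀ i j, i < j → ∀ hj : j < k, rk (E i) < rk (E j) := fun i j hij hj ↦ by
    rw [hErk i (hij.trans hj), hErk j hj]
    exact r.strictMono (Fin.mk_lt_mk.2 hij)
  have hle_rk : ∀ i j, i ≤ j → ∀ hj : j < k, rk (E i) ≤ rk (E j) := fun i j hij hj ↦ by
    rw [hErk i (hij.trans_lt hj), hErk j hj]
    exact r.monotone (Fin.mk_le_mk.2 hij)
  have hsurjE : ∀ e ∈ F, ∃ i < k, E i = e := fun e he ↦ by
    obtain ⟨⟨i, hi⟩, rfl⟩ := hsurj e he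
    exact ⟨i, hi, hE i hi⟩
  -- closeness of the endpoints to the locale
  have hnear : ∀ e ∈ F, zNorm (inP e - e.2) < ℓ ∧ zNorm (outP e - e.2) < ℓ := by
    intro e he
    have hd : zNorm (e.1 - e.2) < ℓ := zNorm_sub_lt_of_mem_zVEdges hℓ (hF he)
    have h0 : zNorm (e.2 - e.2) < ℓ := by
      rw [sub_self]
      change max |(0 : Site 2) 0| |(0 : Site 2) 1| < (ℓ : ℤ)
      simp only [Pi.zero_apply, abs_zero, max_self]
      exact_mod_cast hℓ
    rcases hor e he with h | h <;> rw [Prod.ext_iff] at h <;> obtain ⟨h1, h2⟩ := h <;> simp only at h1 h2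
    · rw [h1, h2]
      exact ⟨hd, h0⟩
    · rw [h1, h2]
      exact ⟨h0, hd⟩
  have hS : zBall x (2 * s) \ zBall x s ⊆ zBall x (2 * s) := fun _ h ↦ h.1
  refine ⟨⟨k, hk, fun i ↦ (E i).2, fun i ↦ inP (E i), fun i ↦ outP (E i), b, b', fun i hi ↦ (hF (hEF i hi)).2.1,
    fun i hi ↦ ?_, fun i hi ↦ (hnear _ (hEF i hi)).1, fun i hi ↦ (hnear _ (hEF i hi)).2, ?_, fun i hi ↦ ?_, ?_,
    fun i hi ↦ hb0 _ (hEF i hi), fun i j hij hj ↦ hlt _ (hEF i (hij.trans hj)) _ (hEF j hj) (hlt_rk i j hij hj),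
    ?_, ?_, fun i hi ↦ ?_⟩⟩
  · -- the locale is an endpoint
    rcases hor _ (hEF i hi) with h | h <;> rw [Prod.ext_iff] at h <;> obtain ⟨-, h2⟩ := h <;> simp only at h2
    · exact Or.inr h2.symm
    · exact Or.inl h2.symm
  · -- `b ⟶ inP (E 0)`: `E 0` has the least rank
    refine hmin _ (hEF 0 hk) fun e' he' ↦ ?_
    obtain ⟨j, hj, rfl⟩ := hsurjE e' he'
    exact hle_rk 0 j (Nat.zero_le j) hj
  · -- consecutive ranks
    refine hcov _ (hEF i (by omega)) _ (hEF (i + 1) hi) (hlt_rk i (i + 1) i.lt_succ_self hi) fun e'' he'' ↦ ?_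
    obtain ⟨j, hj, rfl⟩ := hsurjE e'' he''
    rcases le_or_gt j i with h | h
    · exact Or.inl (hle_rk j i h (by omega))
    · exact Or.inr (hle_rk (i + 1) j h hj)
  · -- `outP (E (k - 1)) ⟶ b'`: `E (k - 1)` has the largest rank
    refine hmax _ (hEF (k - 1) (by omega)) fun e' he' ↦ ?_
    obtain ⟨j, hj, rfl⟩ := hsurjE e' he'
    exact hle_rk j (k - 1) (by omega) (by omega)
  · obtain ⟨-, w, hw, hp⟩ := hb
    exact ⟨w, zNorm_eq_of_mem_outerLayer hw, hp.mono hS⟩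
  · obtain ⟨-, w, hw, hp⟩ := hb'
    exact ⟨w, zNorm_eq_of_mem_outerLayer hw, hp.mono hS⟩
  · obtain ⟨-, -, -, w, hw, w', hw', hd⟩ := hF (hEF i hi)
    exact ⟨w, w', hd, PathIn.mono hS hw, PathIn.mono hS hw'⟩

/-- **The necklace node event in normal form (registered helper, anchor of this module on the crux item)**: for
`1 ≤ ℓ`, every configuration of `ZNodeEventChainA ℓ lam s x o` carries a `Necklace ω ℓ lam s x`
(`exists_necklace`). -/
theorem necklace_of_chainA : ∀ (ℓ lam s : ℕ) (x o : Site 2) (ω : BondConfig (Site 2)), 1 ≤ ℓ → ω ∈ ZNodeEventChainA ℓ lam s x o → Nonempty (Necklace ω ℓ lam s x) :=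
  fun _ _ _ _ _ _ hℓ hω ↦ exists_necklace hℓ hω

end Summit.CriticalPhenomena.CardyFormulaZ2.Cruxes.NestingRigidity.PinchResampling

end
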